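import Literature.RingTheory.MvPolynomial.IdealHomogenization
import Literature.RingTheory.MvPolynomial.HomogeneousHilbertFunction
import Literature.AlgebraicGeometry.Resolution.HironakaGroupSchemeAdditiveGenerators
import HarnessLib

/-!
# Hironaka 1970 (Kyoto), THEOREMS II–IV at a RATIONAL point of the exceptional fibre, as graded
# algebra: the dehomogenised cone has truncated colengths `≤` the Hilbert function of the cone, with
# equality iff the cone is a cylinder along the point — and then its ideal is generated by `U_{g,x'}`

Topic: `Literature/AlgebraicGeometry/Resolution` (stage S1b of the cell res-hironaka reading of
[H4] Th. IV; companion of `Hironaka1970InvariantConeStandardBase.lean`).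

Source: H. Hironaka, *Certain numerical characters of singularities*, J. Math. Kyoto Univ. 10 (1970)
151–187 [`Hironaka1970NumericalCharacters`] (held text
`paper:hironaka1970-certain-numerical-characters-singularities`, PDF page `k` = printed p. `150 + k`).
Read on the page: TH II–IV p. 156 L1–12 («TH II. `H^{(1+d)}_{X',x'} ≤ H^{(1)}_{X,x}` … TH IV. If the
equality of TH III holds, then the tangential cone `C_{X,x}` is invariant by the subgroup `B_{g,x'}` of
`T_{Z,x}`»); (13.1)–(13.2) p. 168 L22–38 («`gr_x(Z,D) = K[X_0, …, X_r]` … `U_{g,x'}` is the graded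
`K`-subalgebra of `K[X]` whose homogeneous part of degree `d` is `{φ ∈ K[X]_d | ν_{x'}(φ/X_0^d) ≥ d}`
… `x'` belongs to the affine piece `Spec(K[T])` of `Proj(K[X])` where `T_i = X_i/X_0` … If `p = 0`,
then `q_i = 1` for all `i`»); p. 169 L33 – p. 170 L2 («let `I'` be the ideal of `f⁻¹(x)` in `K[T]`,
which is generated by `φ/X_0^d` for all `d` and all `φ ∈ I_d`»); p. 170 L3–4 («`C_{X,x}` is invariant by
`B_{g,x'}` if and only if the ideal of `C_{X,x}` in `gr_x(Z)` is generated by elements of `U_{g,x'}`»).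

## What is proved — the RESIDUALLY RATIONAL point `x' = [1 : 0 : ⋯ : 0]`

Pure graded algebra over a field `K` (no scheme, no `ν*`, no group scheme). Cone coordinates
`K[X_0, X_σ] = MvPolynomial (Option σ) K` (`X_0 = X none`), chart coordinates `K[T_σ] = MvPolynomial σ K`
at the rational point `x' = [1 : 0 : ⋯ : 0]` of `Proj K[X_0, X_σ]`, dehomogenisation
`D : φ ↦ φ(1, T)` (`IdealHomogenization.dehomogenization`), `𝔫 = (T_σ)` (`MvPolynomial.idealOfVars`).
For a HOMOGENEOUS ideal `J ⊆ K[X_0, X_σ]` (the ideal `I` of the cone) and `J' = D(J)·K[T]` (the ideal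
`I'` of the fibre `f⁻¹(x)` in the chart, p. 169 L33):

* `finrank_quotient_add_finrank_idealDegree_le` — **TH II at the fibre**: for every `n`,
  `dim_K K[T]/(J' + 𝔫^{n+1}) + dim_K J_n ≤ dim_K K[X_0,X_σ]_n`, i.e. the cumulative Hilbert function
  `H^{(1)}` of the local ring `K[T]_𝔫/J'` (`= 𝒪_{f⁻¹(x),x'}`) is at most the Hilbert function of the cone
  `K[X]/J`. (Mechanism: `φ ↦ φ(1,T)` maps `K[X]_n` ONTO `K[T]/(J' + 𝔫^{n+1})` and kills `J_n`.)
* `forall_finrank_eq_iff_le_span_inter_range_rename` — **TH III/IV at a rational point**: equality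
  holds for all `n` iff `J` is generated by forms in `X_σ` alone, i.e. the cone is a CYLINDER along the
  line `x'` (peeling induction: equality at `n = m − 1` turns `φ ∈ J_m` into `X_0 ψ + φ_m` with `ψ ∈ J`;
  conversely a cylinder ideal is bi-homogeneous).
* `range_rename_some_subset_multAlgebra`, `le_span_inter_multAlgebra_of_forall_finrank_eq` — forms in
  `X_σ` lie in Hironaka's `U(𝔭_{x'})` (`HironakaScheme.multAlgebra`, here `𝔭_{x'} = (X_σ)`), so equality
  yields **the conclusion of TH IV in the p. 170 L3–4 form, `J ≤ span (J ∩ U(𝔭_{x'}))`** — the shape of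
  the cell's typed `Hironaka1970_thmIV_point` (`Hironaka1970NearPointInvariantCone.lean`).

What is NOT here (the remaining steps to `Hironaka1970_thmIV_point` at a `k(x)`-rational near point):
the identification `𝒪_{π⁻¹(x),x'} ≅ K[T]_𝔫/J'` for `J` the tangent-cone ideal in generators adapted to
`x'`, Singh's `H^{(0)}[𝒪_{X',x'}] ≤ H^{(1)}[𝒪_{X',x'}/t]`, and the change to adapted generators; the
non-rational case is [H4] Lemmas 14–20. Nothing here concerns any manuscript under review. AI-written;
AI review is weaker than expert review.

## References

* H. Hironaka, J. Math. Kyoto Univ. 10 (1970) 151–187: TH II–IV p. 156, (13.1)–(13.2) p. 168,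
  p. 169 L33 – p. 170 L9. [Hironaka1970NumericalCharacters]
* V. Cossart, U. Jannsen, S. Saito, LNM 2270 (2020), Thm. 3.10, Def. 3.13, Thm. 3.14 (proof p. 51–52).
  [CossartJannsenSaito2020]
-/

noncomputable section

open MvPolynomial Module
open Literature.RingTheory.MvPolynomial Literature.RingTheory.MvPolynomial.IdealHomogenization

namespace Literature.AlgebraicGeometry.Resolution

universe u v

variable {K : Type u} [Field K] {σ : Type v}

/-! ## 1. Dehomogenisation bookkeeping -/

section Dehomog

/-- `D(φ(X_σ)) = φ(T_σ)`: dehomogenising a polynomial in the `X_σ` alone returns it. [cite: Hironaka1970NumericalCharacters, (13.1) p. 168 (T_i = X_i/X_0)] -/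
theorem dehomogenization_rename_some (q : MvPolynomial σ K) :
    dehomogenization (rename (some : σ → Option σ) q) = q := by
  unfold dehomogenization
  rw [aeval_rename]
  exact aeval_X_left_apply q

/-- Homogeneous components commute with renaming variables (renaming preserves degrees of monomials).
[cite: Hironaka1970NumericalCharacters, (13.1) p. 168] -/
theorem homogeneousComponent_rename {τ : Type*} (f : σ → τ) (q : MvPolynomial σ K) (d : ℕ) :
    homogeneousComponent d (rename f q) = rename f (homogeneousComponent d q) := by
  classical
  conv_lhs => rw [← sum_homogeneousComponent q, map_sum, map_sum]
  rw [Finset.sum_eq_single d]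
  · exact homogeneousComponent_eq_self ((homogeneousComponent_isHomogeneous d q).rename_isHomogeneous)
  · intro e _ hne
    rw [homogeneousComponent_of_mem ((homogeneousComponent_isHomogeneous e q).rename_isHomogeneous),
      if_neg hne.symm]
  · intro hd
    rw [Finset.mem_range, not_lt] at hd
    rw [homogeneousComponent_eq_zero _ _ (lt_of_lt_of_le (Nat.lt_succ_self _) hd), map_zero, map_zero]

/-- A form of degree `m` lies in `𝔫^m`, `𝔫 = (T_σ)`. [cite: Hironaka1970NumericalCharacters, (13.1) p. 168] -/
theorem mem_pow_idealOfVars_of_isHomogeneous {q : MvPolynomial σ K} {m : ℕ} (hq : q.IsHomogeneous m) :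
    q ∈ MvPolynomial.idealOfVars σ K ^ m :=
  (MvPolynomial.mem_pow_idealOfVars_iff' m q).mpr fun _ hx => hq.coeff_eq_zero hx.ne

/-- The components of degree `≤ n` of an element of `𝔫^{n+1}` vanish. [cite: Hironaka1970NumericalCharacters, (13.1) p. 168] -/
theorem homogeneousComponent_eq_zero_of_mem_pow_idealOfVars {b : MvPolynomial σ K} {n k : ℕ}
    (hb : b ∈ MvPolynomial.idealOfVars σ K ^ (n + 1)) (hk : k ≤ n) : homogeneousComponent k b = 0 := by
  classical
  refine homogeneousComponent_eq_zero' _ _ fun d hd hdeg => ?_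
  have := (MvPolynomial.mem_pow_idealOfVars_iff _ _).mp hb d hd
  omega

/-- The truncation `Σ_{k ≤ n} p_k` has total degree `≤ n`. [cite: Hironaka1970NumericalCharacters, (13.1) p. 168] -/
theorem totalDegree_sum_homogeneousComponent_le (p : MvPolynomial σ K) (n : ℕ) :
    (∑ k ∈ Finset.range (n + 1), homogeneousComponent k p).totalDegree ≤ n := by
  refine (totalDegree_finsetSum _ _).trans (Finset.sup_le fun k hk => ?_)
  have hk' : k ≤ n := Nat.lt_succ_iff.mp (Finset.mem_range.mp hk)
  by_cases h0 : homogeneousComponent k p = 0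
  · rw [h0, totalDegree_zero]
    exact Nat.zero_le _
  · rw [(homogeneousComponent_isHomogeneous k p).totalDegree h0]
    exact hk'

/-- `p ≡ Σ_{k ≤ n} p_k (mod 𝔫^{n+1})`. [cite: Hironaka1970NumericalCharacters, (13.1) p. 168] -/
theorem sub_sum_homogeneousComponent_mem_pow_idealOfVars (p : MvPolynomial σ K) (n : ℕ) :
    p - ∑ k ∈ Finset.range (n + 1), homogeneousComponent k p ∈
      MvPolynomial.idealOfVars σ K ^ (n + 1) := by
  classical
  rw [MvPolynomial.mem_pow_idealOfVars_iff']
  intro x hx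
  simp only [coeff_sub, coeff_sum, coeff_homogeneousComponent, Finset.sum_ite_eq, Finset.mem_range]
  rw [if_pos hx, sub_self]

/-- A polynomial of total degree `≤ m` is the sum of its components of degrees `≤ m`.
[cite: Hironaka1970NumericalCharacters, (13.1) p. 168] -/
theorem sum_homogeneousComponent_of_totalDegree_le {p : MvPolynomial σ K} {m : ℕ}
    (hp : p.totalDegree ≤ m) : ∑ k ∈ Finset.range (m + 1), homogeneousComponent k p = p := by
  classical
  conv_rhs => rw [← sum_homogeneousComponent p]
  refine (Finset.sum_subset (Finset.range_mono (Nat.succ_le_succ hp)) fun k _ hk' => ?_).symm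
  rw [Finset.mem_range, not_lt] at hk'
  exact homogeneousComponent_eq_zero _ _ (by omega)

/-- **`X_0`-adic peeling of a form.** A form `φ` of degree `m + 1` in `K[X_0, X_σ]` is
`X_0 · ψ + φ_{m+1}(X_σ)` with `ψ` the form of degree `m` whose dehomogenisation is `φ(1,T)` minus its
top component, and `φ_{m+1}` the top component of `φ(1,T)` written in the `X_σ`.
[cite: Hironaka1970NumericalCharacters, p. 169 L33 – p. 170 L2 (ψ_i = φ_i/X_0^{d_i})] -/
theorem eq_X_none_mul_add_rename_of_isHomogeneous {φ : MvPolynomial (Option σ) K} {m : ℕ}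
    (hφ : φ.IsHomogeneous (m + 1)) :
    φ = X none * homogenizeTo m (∑ k ∈ Finset.range (m + 1),
        homogeneousComponent k (dehomogenization φ)) +
      rename some (homogeneousComponent (m + 1) (dehomogenization φ)) := by
  set p := dehomogenization φ with hp
  have hdeg : p.totalDegree ≤ m + 1 := totalDegree_dehomogenization_le hφ
  have htr := totalDegree_sum_homogeneousComponent_le p m
  refine eq_of_dehomogenization_eq hφ ?_ ?_
  · refine IsHomogeneous.add ?_ (homogeneousComponent_isHomogeneous _ _).rename_isHomogeneous
    have := (isHomogeneous_X K (none : Option σ)).mul (homogenizeTo_isHomogeneous htr)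
    rwa [add_comm 1 m] at this
  · rw [map_add, map_mul, dehomogenization_X_none, one_mul, dehomogenization_homogenizeTo,
      dehomogenization_rename_some, ← hp]
    conv_lhs => rw [← sum_homogeneousComponent_of_totalDegree_le hdeg]
    rw [Finset.sum_range_succ]

/-- **`X_0`-adic expansion of a form.** A form `φ` of degree `n` in `K[X_0, X_σ]` is
`Σ_{k ≤ n} X_0^{n−k} · φ_k(X_σ)` with `φ_k` the degree-`k` component of `φ(1,T)`.
[cite: Hironaka1970NumericalCharacters, p. 169 L33 – p. 170 L2] -/
theorem eq_sum_X_none_pow_mul_rename_of_isHomogeneous {φ : MvPolynomial (Option σ) K} {n : ℕ}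
    (hφ : φ.IsHomogeneous n) :
    φ = ∑ k ∈ Finset.range (n + 1),
      X none ^ (n - k) * rename some (homogeneousComponent k (dehomogenization φ)) := by
  have hdeg : (dehomogenization φ).totalDegree ≤ n := totalDegree_dehomogenization_le hφ
  refine eq_of_dehomogenization_eq hφ ?_ ?_
  · refine IsHomogeneous.sum _ _ _ fun k hk => ?_
    have hk' : k ≤ n := Nat.lt_succ_iff.mp (Finset.mem_range.mp hk)
    have := ((isHomogeneous_X K (none : Option σ)).pow (n - k)).mul
      ((homogeneousComponent_isHomogeneous k (dehomogenization φ)).rename_isHomogeneous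
        (f := (some : σ → Option σ)))
    rwa [one_mul, Nat.sub_add_cancel hk'] at this
  · rw [map_sum]
    simp only [map_mul, map_pow, dehomogenization_X_none, one_pow, one_mul, dehomogenization_rename_some]
    exact (sum_homogeneousComponent_of_totalDegree_le hdeg).symm

end Dehomog

/-! ## 2. TH II at the fibre: the dehomogenised cone has smaller truncated colengths -/

section Inequality

variable [Fintype σ] (J : Ideal (MvPolynomial (Option σ) K)) (n : ℕ)

omit [Fintype σ] in
/-- The comparison map `K[X_0,X_σ]_n → K[T]/(J' + 𝔫^{n+1})`, `φ ↦ φ(1,T)`, where `J' = D(J)·K[T]`.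
(An auxiliary linear map, spelled out; no new notion.) [cite: Hironaka1970NumericalCharacters, p. 169 L33 – p. 170 L2] -/
theorem dehomQuot_apply (φ : homogeneousSubmodule (Option σ) K n) :
    (((Ideal.Quotient.mkₐ K (J.map (dehomogenization (R := K) (σ := σ)) ⊔
        MvPolynomial.idealOfVars σ K ^ (n + 1))).toLinearMap ∘ₗ
        (dehomogenization (R := K) (σ := σ)).toLinearMap).domRestrict
        (homogeneousSubmodule (Option σ) K n)) φ =
      Ideal.Quotient.mk _ (dehomogenization (φ : MvPolynomial (Option σ) K)) := rfl

omit [Fintype σ] in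
/-- **`φ ↦ φ(1,T)` maps the forms of degree `n` ONTO `K[T]/(J' + 𝔫^{n+1})`**: every class has a
representative of degree `≤ n`, which is the dehomogenisation of its padded homogenisation.
[cite: Hironaka1970NumericalCharacters, p. 169 L33 – p. 170 L2] -/
theorem dehomQuot_surjective :
    Function.Surjective
      (((Ideal.Quotient.mkₐ K (J.map (dehomogenization (R := K) (σ := σ)) ⊔
        MvPolynomial.idealOfVars σ K ^ (n + 1))).toLinearMap ∘ₗ
        (dehomogenization (R := K) (σ := σ)).toLinearMap).domRestrict
        (homogeneousSubmodule (Option σ) K n)) := by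
  intro c
  obtain ⟨p, rfl⟩ := Ideal.Quotient.mk_surjective c
  let p' := ∑ k ∈ Finset.range (n + 1), homogeneousComponent k p
  have hp' : p'.totalDegree ≤ n := totalDegree_sum_homogeneousComponent_le p n
  refine ⟨⟨homogenizeTo n p', homogenizeTo_isHomogeneous hp'⟩, ?_⟩
  rw [dehomQuot_apply, Subtype.coe_mk, dehomogenization_homogenizeTo, Ideal.Quotient.eq]
  refine Ideal.mem_sup_right ?_
  have := sub_sum_homogeneousComponent_mem_pow_idealOfVars p n
  rwa [← neg_sub, neg_mem_iff] at this

omit [Fintype σ] in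
/-- **`J_n` is killed**: a form of degree `n` lying in `J` dehomogenises into `J'`.
[cite: Hironaka1970NumericalCharacters, p. 169 L33 – p. 170 L2] -/
theorem idealDegree_comap_le_ker :
    (idealDegree J n).comap (homogeneousSubmodule (Option σ) K n).subtype ≤
      LinearMap.ker
        (((Ideal.Quotient.mkₐ K (J.map (dehomogenization (R := K) (σ := σ)) ⊔
          MvPolynomial.idealOfVars σ K ^ (n + 1))).toLinearMap ∘ₗ
          (dehomogenization (R := K) (σ := σ)).toLinearMap).domRestrict
          (homogeneousSubmodule (Option σ) K n)) := by
  intro φ hφ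
  rw [LinearMap.mem_ker, dehomQuot_apply, Ideal.Quotient.eq_zero_iff_mem]
  exact Ideal.mem_sup_left (Ideal.mem_map_of_mem _ (mem_idealDegree.mp hφ).1)

/-- **[H4] TH II at the exceptional fibre, rational point `x' = [1:0:⋯:0]`.** For a homogeneous-or-not
ideal `J ⊆ K[X_0,X_σ]` and every `n`:
`dim_K K[T]/(J' + 𝔫^{n+1}) + dim_K J_n ≤ dim_K K[X_0,X_σ]_n`, `J' = J(1,T)·K[T]` — the cumulative
Hilbert function `H^{(1)}` of `K[T]_𝔫/J'` is bounded by the Hilbert function of the cone `K[X]/J`.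
[cite: Hironaka1970NumericalCharacters, TH II p. 156 L1–2] -/
theorem finrank_quotient_add_finrank_idealDegree_le :
    finrank K (MvPolynomial σ K ⧸ (J.map (dehomogenization (R := K) (σ := σ)) ⊔
        MvPolynomial.idealOfVars σ K ^ (n + 1))) +
      finrank K (idealDegree J n) ≤ finrank K (homogeneousSubmodule (Option σ) K n) := by
  haveI := finite_homogeneousSubmodule (K := K) (σ := Option σ) n
  set Φ := ((Ideal.Quotient.mkₐ K (J.map (dehomogenization (R := K) (σ := σ)) ⊔
        MvPolynomial.idealOfVars σ K ^ (n + 1))).toLinearMap ∘ₗ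
        (dehomogenization (R := K) (σ := σ)).toLinearMap).domRestrict
        (homogeneousSubmodule (Option σ) K n) with hΦ
  have hrn := LinearMap.finrank_range_add_finrank_ker Φ
  rw [LinearMap.range_eq_top.mpr (dehomQuot_surjective J n), finrank_top] at hrn
  have hker : finrank K (idealDegree J n) ≤ finrank K (LinearMap.ker Φ) := by
    rw [← LinearEquiv.finrank_eq (Submodule.comapSubtypeEquivOfLe
      (idealDegree_le_homogeneousSubmodule J n))]
    exact Submodule.finrank_mono (idealDegree_comap_le_ker J n)
  omega

/-- **Equality at `n` forces the kernel**: if `dim K[T]/(J' + 𝔫^{n+1}) + dim J_n = dim K[X]_n` then a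
form `φ` of degree `n` with `φ(1,T) ∈ J' + 𝔫^{n+1}` lies in `J`. [cite: Hironaka1970NumericalCharacters, TH III p. 156 L7–10] -/
theorem mem_of_dehomogenization_mem_of_finrank_eq
    (heq : finrank K (MvPolynomial σ K ⧸ (J.map (dehomogenization (R := K) (σ := σ)) ⊔
        MvPolynomial.idealOfVars σ K ^ (n + 1))) +
      finrank K (idealDegree J n) = finrank K (homogeneousSubmodule (Option σ) K n))
    {φ : MvPolynomial (Option σ) K} (hφ : φ.IsHomogeneous n)
    (hD : dehomogenization φ ∈ J.map (dehomogenization (R := K) (σ := σ)) ⊔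
        MvPolynomial.idealOfVars σ K ^ (n + 1)) : φ ∈ J := by
  haveI := finite_homogeneousSubmodule (K := K) (σ := Option σ) n
  set Φ := ((Ideal.Quotient.mkₐ K (J.map (dehomogenization (R := K) (σ := σ)) ⊔
        MvPolynomial.idealOfVars σ K ^ (n + 1))).toLinearMap ∘ₗ
        (dehomogenization (R := K) (σ := σ)).toLinearMap).domRestrict
        (homogeneousSubmodule (Option σ) K n) with hΦ
  have hrn := LinearMap.finrank_range_add_finrank_ker Φ
  rw [LinearMap.range_eq_top.mpr (dehomQuot_surjective J n), finrank_top] at hrn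
  have hle := idealDegree_comap_le_ker J n
  have hfin : finrank K ((idealDegree J n).comap (homogeneousSubmodule (Option σ) K n).subtype) =
      finrank K (LinearMap.ker Φ) := by
    rw [LinearEquiv.finrank_eq (Submodule.comapSubtypeEquivOfLe
      (idealDegree_le_homogeneousSubmodule J n))]
    omega
  have hkereq := Submodule.eq_of_le_of_finrank_eq hle hfin
  have hmem : (⟨φ, hφ⟩ : homogeneousSubmodule (Option σ) K n) ∈ LinearMap.ker Φ := by
    rw [LinearMap.mem_ker, hΦ, dehomQuot_apply, Ideal.Quotient.eq_zero_iff_mem]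
    exact hD
  rw [← hkereq] at hmem
  exact (mem_idealDegree.mp hmem).1

end Inequality

/-! ## 3. TH III/IV at a rational point: equality iff the cone is a cylinder along `x'` -/

section Cylinder

variable [Fintype σ] {J : Ideal (MvPolynomial (Option σ) K)}

/-- **Equality ⇒ cylinder.** If `J` is homogeneous and `dim K[T]/(J' + 𝔫^{n+1}) + dim J_n = dim K[X]_n`
for every `n`, then `J` is generated by its elements not involving `X_0` (forms in the `X_σ`): the cone
`V(J)` is a cylinder along the line `x' = [1:0:⋯:0]`. Peeling induction on the degree: for
`φ ∈ J_{m+1}` write `φ = X_0 ψ + φ_{m+1}(X_σ)`; `ψ(1,T) = φ(1,T) − φ_{m+1} ∈ J' + 𝔫^{m+1}`, so equality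
at `m` gives `ψ ∈ J`, and `φ_{m+1}(X_σ) = φ − X_0 ψ ∈ J`. [cite: Hironaka1970NumericalCharacters, TH IV p. 156 L11–12, p. 170 L3–4] -/
theorem le_span_inter_range_rename_of_forall_finrank_eq
    (hJ : ∀ f ∈ J, ∀ d : ℕ, homogeneousComponent d f ∈ J)
    (heq : ∀ n, finrank K (MvPolynomial σ K ⧸ (J.map (dehomogenization (R := K) (σ := σ)) ⊔
        MvPolynomial.idealOfVars σ K ^ (n + 1))) +
      finrank K (idealDegree J n) = finrank K (homogeneousSubmodule (Option σ) K n)) :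
    J ≤ Ideal.span ((J : Set (MvPolynomial (Option σ) K)) ∩
      Set.range (rename (some : σ → Option σ))) := by
  -- every FORM of `J` lies in the span, by induction on the degree
  have key : ∀ m : ℕ, ∀ φ : MvPolynomial (Option σ) K, φ ∈ J → φ.IsHomogeneous m →
      φ ∈ Ideal.span ((J : Set (MvPolynomial (Option σ) K)) ∩
        Set.range (rename (some : σ → Option σ))) := by
    intro m
    induction m with
    | zero =>
      intro φ hφJ hφ0
      refine Ideal.subset_span ⟨hφJ, C (coeff 0 φ), ?_⟩
      rw [rename_C, ← homogeneousComponent_zero φ, homogeneousComponent_eq_self hφ0]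
    | succ m ih =>
      intro φ hφJ hφ
      set q := homogeneousComponent (m + 1) (dehomogenization φ) with hq
      set ψ := homogenizeTo m (∑ k ∈ Finset.range (m + 1),
        homogeneousComponent k (dehomogenization φ)) with hψ
      have hdec : φ = X none * ψ + rename some q := eq_X_none_mul_add_rename_of_isHomogeneous hφ
      have hψhom : ψ.IsHomogeneous m :=
        homogenizeTo_isHomogeneous (totalDegree_sum_homogeneousComponent_le _ m)
      -- `ψ(1,T) = φ(1,T) − q ∈ J' + 𝔫^{m+1}`
      have hψJ : ψ ∈ J := by
        refine mem_of_dehomogenization_mem_of_finrank_eq J m (heq m) hψhom ?_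
        have hDψ : dehomogenization ψ = dehomogenization φ - q := by
          rw [hψ, dehomogenization_homogenizeTo, eq_sub_iff_add_eq,
            ← Finset.sum_range_succ (fun k => homogeneousComponent k (dehomogenization φ)) (m + 1)]
          exact sum_homogeneousComponent_of_totalDegree_le (totalDegree_dehomogenization_le hφ)
        rw [hDψ]
        exact Submodule.sub_mem _ (Ideal.mem_sup_left (Ideal.mem_map_of_mem _ hφJ))
          (Ideal.mem_sup_right (mem_pow_idealOfVars_of_isHomogeneous
            (homogeneousComponent_isHomogeneous _ _)))
      have hqJ : rename some q ∈ J := by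
        have : rename some q = φ - X none * ψ := by rw [hdec]; ring
        rw [this]
        exact Submodule.sub_mem _ hφJ (Ideal.mul_mem_left _ _ hψJ)
      rw [hdec]
      exact Submodule.add_mem _ (Ideal.mul_mem_left _ _ (ih ψ hψJ hψhom))
        (Ideal.subset_span ⟨hqJ, q, rfl⟩)
  intro f hf
  rw [← sum_homogeneousComponent f]
  exact Ideal.sum_mem _ fun d _ => key d _ (hJ f hf d) (homogeneousComponent_isHomogeneous d f)

omit [Fintype σ] in
/-- The pull-back `J₀ = {q ∈ K[T] : q(X_σ) ∈ J}` of a homogeneous ideal is closed under homogeneous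
components. [cite: Hironaka1970NumericalCharacters, (13.1) p. 168] -/
theorem homogeneousComponent_mem_comap_rename (hJ : ∀ f ∈ J, ∀ d : ℕ, homogeneousComponent d f ∈ J)
    {q : MvPolynomial σ K} (hq : q ∈ J.comap (rename (some : σ → Option σ))) (d : ℕ) :
    homogeneousComponent d q ∈ J.comap (rename (some : σ → Option σ)) := by
  rw [Ideal.mem_comap, ← homogeneousComponent_rename]
  exact hJ _ (Ideal.mem_comap.mp hq) d

omit [Fintype σ] in
/-- For a CYLINDER ideal (generated by elements not involving `X_0`) the dehomogenised ideal `J'` is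
contained in the pull-back `J₀ = {q : q(X_σ) ∈ J}`. [cite: Hironaka1970NumericalCharacters, p. 169 L33 – p. 170 L4] -/
theorem map_dehomogenization_le_comap_rename_of_le_span
    (hJR : J ≤ Ideal.span ((J : Set (MvPolynomial (Option σ) K)) ∩
      Set.range (rename (some : σ → Option σ)))) :
    J.map (dehomogenization (R := K) (σ := σ)) ≤ J.comap (rename (some : σ → Option σ)) := by
  refine (Ideal.map_mono hJR).trans ?_
  rw [Ideal.map_span, Ideal.span_le]
  rintro _ ⟨g, ⟨hgJ, q, rfl⟩, rfl⟩
  rw [SetLike.mem_coe, Ideal.mem_comap, dehomogenization_rename_some]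
  exact hgJ

/-- **Cylinder ⇒ equality.** If the homogeneous ideal `J` is generated by elements not involving `X_0`,
then `dim K[T]/(J' + 𝔫^{n+1}) + dim J_n = dim K[X]_n` for every `n`: a form `φ` of degree `n` with
`φ(1,T) ∈ J' + 𝔫^{n+1}` has all components `φ(1,T)_k` (`k ≤ n`) in `J₀`, and
`φ = Σ_k X_0^{n−k} φ(1,T)_k(X_σ) ∈ J`. [cite: Hironaka1970NumericalCharacters, TH III p. 156 L7–10, p. 170 L3–4] -/
theorem forall_finrank_eq_of_le_span_inter_range_rename
    (hJ : ∀ f ∈ J, ∀ d : ℕ, homogeneousComponent d f ∈ J)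
    (hJR : J ≤ Ideal.span ((J : Set (MvPolynomial (Option σ) K)) ∩
      Set.range (rename (some : σ → Option σ)))) (n : ℕ) :
    finrank K (MvPolynomial σ K ⧸ (J.map (dehomogenization (R := K) (σ := σ)) ⊔
        MvPolynomial.idealOfVars σ K ^ (n + 1))) +
      finrank K (idealDegree J n) = finrank K (homogeneousSubmodule (Option σ) K n) := by
  haveI := finite_homogeneousSubmodule (K := K) (σ := Option σ) n
  set Φ := ((Ideal.Quotient.mkₐ K (J.map (dehomogenization (R := K) (σ := σ)) ⊔
        MvPolynomial.idealOfVars σ K ^ (n + 1))).toLinearMap ∘ₗ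
        (dehomogenization (R := K) (σ := σ)).toLinearMap).domRestrict
        (homogeneousSubmodule (Option σ) K n) with hΦ
  have hrn := LinearMap.finrank_range_add_finrank_ker Φ
  rw [LinearMap.range_eq_top.mpr (dehomQuot_surjective J n), finrank_top] at hrn
  -- the kernel IS `J_n`
  suffices hker : LinearMap.ker Φ ≤ (idealDegree J n).comap (homogeneousSubmodule (Option σ) K n).subtype by
    have hkereq := le_antisymm (idealDegree_comap_le_ker J n) hker
    rw [← hkereq, LinearEquiv.finrank_eq (Submodule.comapSubtypeEquivOfLe
      (idealDegree_le_homogeneousSubmodule J n))] at hrn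
    omega
  rintro ⟨φ, hφ⟩ hmem
  rw [LinearMap.mem_ker, hΦ, dehomQuot_apply, Subtype.coe_mk, Ideal.Quotient.eq_zero_iff_mem] at hmem
  change φ ∈ idealDegree J n
  refine mem_idealDegree.mpr ⟨?_, hφ⟩
  obtain ⟨a, ha, b, hb, hab⟩ := Submodule.mem_sup.mp hmem
  have haJ₀ : a ∈ J.comap (rename (some : σ → Option σ)) :=
    map_dehomogenization_le_comap_rename_of_le_span hJR ha
  -- components of `φ(1,T)` of degree `≤ n` are those of `a`, hence in `J₀`
  have hcomp : ∀ k, k ≤ n →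
      rename some (homogeneousComponent k (dehomogenization φ)) ∈ J := by
    intro k hk
    have : homogeneousComponent k (dehomogenization φ) = homogeneousComponent k a := by
      rw [← hab, map_add, homogeneousComponent_eq_zero_of_mem_pow_idealOfVars hb hk, add_zero]
    rw [this]
    exact Ideal.mem_comap.mp (homogeneousComponent_mem_comap_rename hJ haJ₀ k)
  rw [eq_sum_X_none_pow_mul_rename_of_isHomogeneous hφ]
  exact Ideal.sum_mem _ fun k hk =>
    Ideal.mul_mem_left _ _ (hcomp k (Nat.lt_succ_iff.mp (Finset.mem_range.mp hk)))

/-- **[H4] TH III ⟺ TH IV at a RATIONAL point of the exceptional fibre, as graded algebra.** For a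
homogeneous ideal `J ⊆ K[X_0,X_σ]`: the truncated colengths of the dehomogenised ideal at
`x' = [1:0:⋯:0]` attain the bound of `finrank_quotient_add_finrank_idealDegree_le` for every `n` iff
`J` is generated by elements not involving `X_0` (the cone is a cylinder along `x'`).
[cite: Hironaka1970NumericalCharacters, TH III–IV p. 156 L7–12, p. 170 L3–4] -/
theorem forall_finrank_eq_iff_le_span_inter_range_rename
    (hJ : ∀ f ∈ J, ∀ d : ℕ, homogeneousComponent d f ∈ J) :
    (∀ n, finrank K (MvPolynomial σ K ⧸ (J.map (dehomogenization (R := K) (σ := σ)) ⊔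
        MvPolynomial.idealOfVars σ K ^ (n + 1))) +
      finrank K (idealDegree J n) = finrank K (homogeneousSubmodule (Option σ) K n)) ↔
    J ≤ Ideal.span ((J : Set (MvPolynomial (Option σ) K)) ∩
      Set.range (rename (some : σ → Option σ))) :=
  ⟨le_span_inter_range_rename_of_forall_finrank_eq hJ,
    fun h n => forall_finrank_eq_of_le_span_inter_range_rename hJ h n⟩

end Cylinder

/-! ## 4. The conclusion of TH IV: generation by elements of `U(𝔭_{x'})` -/

section MultAlgebra

/-- The homogeneous prime `𝔭_{x'} = (X_σ)` of the rational point `x' = [1:0:⋯:0]` is the image of `𝔫`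
under `T ↦ X_σ`. [cite: Hironaka1970NumericalCharacters, (13.1) p. 168] -/
theorem map_rename_idealOfVars :
    (MvPolynomial.idealOfVars σ K).map (rename (some : σ → Option σ)) =
      Ideal.span (Set.range fun i : σ => (X (some i) : MvPolynomial (Option σ) K)) := by
  rw [MvPolynomial.idealOfVars, Ideal.map_span, ← Set.range_comp,
    show (⇑(rename (some : σ → Option σ)) ∘ (X : σ → MvPolynomial σ K)) = fun i => X (some i) from
      funext fun i => rename_X _ _]

/-- `𝔭_{x'} = (X_σ)` is a proper ideal. [cite: Hironaka1970NumericalCharacters, (13.1) p. 168] -/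
theorem span_X_some_ne_top :
    Ideal.span (Set.range fun i : σ => (X (some i) : MvPolynomial (Option σ) K)) ≠ ⊤ := by
  intro h
  have hle : Ideal.span (Set.range fun i : σ => (X (some i) : MvPolynomial (Option σ) K)) ≤
      RingHom.ker (constantCoeff : MvPolynomial (Option σ) K →+* K) := by
    rw [Ideal.span_le]
    rintro _ ⟨i, rfl⟩
    rw [SetLike.mem_coe, RingHom.mem_ker]
    exact constantCoeff_X K (some i)
  have h1 : (1 : MvPolynomial (Option σ) K) ∈
      RingHom.ker (constantCoeff : MvPolynomial (Option σ) K →+* K) := hle (h ▸ Submodule.mem_top)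
  rw [RingHom.mem_ker, map_one] at h1
  exact one_ne_zero h1

/-- **Polynomials in the `X_σ` lie in `U(𝔭_{x'})`**, `𝔭_{x'} = (X_σ)` the homogeneous prime of the rational
point `x' = [1:0:⋯:0]`: a form of degree `d` in the `X_σ` lies in `𝔭_{x'}^d`, so has multiplicity `≥ d`
at `x'` (for a rational point the `θ_i` of (13.2) are the linear forms vanishing at `x'`, «`q_i = 1`»).
[cite: Hironaka1970NumericalCharacters, (13.1)–(13.2) p. 168 L28–38] -/
theorem range_rename_some_subset_multAlgebra :
    Set.range (rename (some : σ → Option σ) : MvPolynomial σ K → MvPolynomial (Option σ) K) ⊆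
      (HironakaScheme.multAlgebra K
        (Ideal.span (Set.range fun i : σ => (X (some i) : MvPolynomial (Option σ) K))) :
        Set (MvPolynomial (Option σ) K)) := by
  classical
  rintro _ ⟨q, rfl⟩
  rw [SetLike.mem_coe, ← sum_homogeneousComponent q, map_sum]
  refine Subalgebra.sum_mem _ fun d _ => Algebra.subset_adjoin ⟨d, ?_, ?_⟩
  · exact (homogeneousComponent_isHomogeneous d q).rename_isHomogeneous
  · refine HironakaScheme.mem_symbPow_of_mem_pow span_X_some_ne_top ?_
    rw [← map_rename_idealOfVars, ← Ideal.map_pow]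
    exact Ideal.mem_map_of_mem _
      (mem_pow_idealOfVars_of_isHomogeneous (homogeneousComponent_isHomogeneous d q))

/-- A cylinder ideal along `x'` is generated by elements of `U(𝔭_{x'})`. [cite: Hironaka1970NumericalCharacters, p. 170 L3–4] -/
theorem le_span_inter_multAlgebra_of_le_span_inter_range_rename {J : Ideal (MvPolynomial (Option σ) K)}
    (hJR : J ≤ Ideal.span ((J : Set (MvPolynomial (Option σ) K)) ∩
      Set.range (rename (some : σ → Option σ)))) :
    J ≤ Ideal.span ((J : Set (MvPolynomial (Option σ) K)) ∩
      (HironakaScheme.multAlgebra K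
        (Ideal.span (Set.range fun i : σ => (X (some i) : MvPolynomial (Option σ) K))) :
        Set (MvPolynomial (Option σ) K))) :=
  hJR.trans (Ideal.span_mono (Set.inter_subset_inter_right _ range_rename_some_subset_multAlgebra))

variable [Fintype σ]

/-- **[H4] THEOREM IV at a rational point, graded-algebra core.** If the homogeneous ideal `J` of the
cone satisfies `dim K[T]/(J' + 𝔫^{n+1}) + dim J_n = dim K[X_0,X_σ]_n` for every `n` (the equality case of
TH II at the rational point `x' = [1:0:⋯:0]` of the exceptional fibre), then `J` is generated by its
elements lying in Hironaka's `U(𝔭_{x'})` — «`C_{X,x}` is invariant by `B_{g,x'}`» in the p. 170 L3–4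
form, the conclusion shape of the cell's `Hironaka1970_thmIV_point`.
[cite: Hironaka1970NumericalCharacters, TH IV p. 156 L11–12, p. 170 L3–4] -/
theorem le_span_inter_multAlgebra_of_forall_finrank_eq {J : Ideal (MvPolynomial (Option σ) K)}
    (hJ : ∀ f ∈ J, ∀ d : ℕ, homogeneousComponent d f ∈ J)
    (heq : ∀ n, finrank K (MvPolynomial σ K ⧸ (J.map (dehomogenization (R := K) (σ := σ)) ⊔
        MvPolynomial.idealOfVars σ K ^ (n + 1))) +
      finrank K (idealDegree J n) = finrank K (homogeneousSubmodule (Option σ) K n)) :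
    J ≤ Ideal.span ((J : Set (MvPolynomial (Option σ) K)) ∩
      (HironakaScheme.multAlgebra K
        (Ideal.span (Set.range fun i : σ => (X (some i) : MvPolynomial (Option σ) K))) :
        Set (MvPolynomial (Option σ) K))) :=
  le_span_inter_multAlgebra_of_le_span_inter_range_rename
    (le_span_inter_range_rename_of_forall_finrank_eq hJ heq)

end MultAlgebra

end Literature.AlgebraicGeometry.Resolution

end
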